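import Mathlib
import Literature.NumberTheory.Transcendental.PeriodsWave0
import HarnessLib

/-!
# Apéry's two series: `ζ(2) = 3 Σ 1/(n² binom(2n,n))`, `ζ(3) = (5/2) Σ (-1)^{n-1}/(n³ binom(2n,n))`

Source: A. J. van der Poorten, *Some wonderful formulae... Footnotes to Apéry's proof of the
irrationality of ζ(3)*, Séminaire Delange–Pisot–Poitou (Théorie des nombres) **20** (1978/79),
no. 2, exposé n° 29, 7 pp. [VanDerPoorten1979Formulae], §1 (p. 29-01).  For details the exposé
refers to the author's report *A proof that Euler missed...* [VanDerPoorten1979] (its reference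
[5]).

§1, verbatim (p. 29-01): "In his notorious lecture at Marseille, APÉRY reminded his audience of
two curious formulae:
(1) `ζ(2) = π²/6 = Σ₁^∞ 1/n² = 3 Σ₁^∞ 1/(n² binom(2n,n))`,
(2) `ζ(3) = Σ₁^∞ 1/n³ = (5/2) Σ₁^∞ (-1)^{n-1}/(n³ binom(2n,n))`.
These expressions can be proved in a quite straightforward way. In fact, writing
`X_{n,k} = (-1)^{k-1} (k-1)!² n (n-k-1)! / (n+k)!`, `k < n`, one has
`X_{n,k} = D_{n,k-1} - D_{n,k}` with `D_{n,k} = (-1)^k k!² (n-k-1)! / (n (n+k)!)`,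
`(-1)^{n-1} X_{n,k} = F_{n,k} - F_{n-1,k}` with
`F_{n,k} = ½ (-1)^{n+k} (k-1)!² (n-k)! / (n+k)! = ½ (-1)^{n+k} / (k² binom(n+k,k) binom(n,k))`,
`(1/n) X_{n,k} = E_{n,k} - E_{n-1,k}` with
`E_{n,k} = ½ (-1)^k (k-1)!² (n-k)! / (k (n+k)!) = ½ (-1)^k / (k³ binom(n+k,k) binom(n,k))`,
and the formulae readily follow."

## Contents

* The kernels `X`, `D`, `F`, `E` as real numbers and the three displayed identities
  (`X_eq_D_sub_D`, `neg_one_pow_mul_X`, `X_div`), with the binomial forms of `F` and `E`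
  (`F_eq_choose`, `E_eq_choose`).
* "The formulae readily follow", spelled out.  Summing over `1 ≤ k ≤ n - 1` telescopes in `D`
  (`sum_X`: `Σ_k X_{n,k} = 1/n² - 2(-1)^{n-1}/(n² binom(2n,n))`); multiplying by `(-1)^{n-1}`,
  resp. `1/n`, and summing over `n ≤ N` telescopes in `F`, resp. `E` (`partialSum_two`,
  `partialSum_three`); the boundary sums `Σ_{k ≤ N} F_{N,k}`, `Σ_{k ≤ N} E_{N,k}` are `O(1/N)`
  (`abs_sum_F_le`, `abs_sum_E_le`).  Letting `N → ∞` gives (2) (`hasSum_alt_binomTerm_three`,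
  `zetaValue_three_eq`, and for Mathlib's zeta function `riemannZeta_three_eq`) and, through
  the alternating sum `Σ (-1)^{n-1}/n² = π²/12 = ζ(2)/2` (this is where `3 = (3/2) · 2` comes
  from), formula (1) (`hasSum_binomTerm_two`, `pi_sq_div_six_eq_three_mul_tsum_binomTerm`,
  `zetaValue_two_eq_three_mul_tsum`, `riemannZeta_two_eq_three_mul_tsum`).
* Truncations of (1) and (2) (uses of the cited formulae; the truncations themselves are not
  printed in the source): the term ratio of `Σ 1/(n^p binom(2n,n))` is `≤ 1/4`, so the tail
  after the last kept term is at most a third of that term (private helpers `binomTerm_succ_le`,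
  `tsum_binomTerm_tail_le`); hence the two-sided enclosure of `π²/6` by the partial sums of (1)
  (`pi_sq_div_six_mem_Ioc`), and the alternating-series enclosure of `ζ(3)` by the partial sums
  of (2) (`abs_zetaValue_three_sub_partialSum_le`, via Mathlib's `alternating_series_error_bound`).

## Conventions; what is not here

* A series "`Σ₁^∞`" is a sum over `ℕ` whose `n = 0` term is `0` (Lean's `1/0 = 0`), or is written
  in the shifted index `i = n - 1`; both forms are provided for (1) and (2).  On the real side
  "`ζ(k) = Σ₁^∞ 1/n^k`" is the tree's `zetaValue k := ∑' n : ℕ, 1 / (n : ℝ) ^ k`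
  (`PeriodsWave0.lean`, with `ofReal_zetaValue : (zetaValue k : ℂ) = riemannZeta k`); the
  `ℂ`-valued statements use Mathlib's `riemannZeta` (`riemannZeta_two`).
* The kernels involve `(k-1)!`, `(n-k-1)!`, `(n-k)!` with natural-number subtraction: outside the
  printed ranges (`1 ≤ k < n`, resp. `1 ≤ k ≤ n`) they take junk values that no statement uses.
* Not formalised: formulae (3) `ζ(4) = (36/17) Σ 1/(n⁴ binom(2n,n))` and (4) of §1, and §§2–4
  (the polylogarithm and Clausen-function evaluations and the integrals (5)–(8)).
-/

noncomputable section

open Finset Filter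
open scoped BigOperators Nat Topology Real
open Literature.NumberTheory.Transcendental (zetaValue ofReal_zetaValue)

namespace Literature.NumberTheory.Irrationality.VanDerPoorten1979

/-- The kernel `X_{n,k} = (-1)^{k-1} (k-1)!² n (n-k-1)! / (n+k)!`, printed for `k < n` (as a real
number; `k - 1`, `n - k - 1` are natural-number subtractions, so outside `1 ≤ k < n` the value is a
harmless junk value that no statement below uses). [cite: VanDerPoorten1979Formulae, §1 p. 29-01] -/
def X (n k : ℕ) : ℝ :=
  (-1) ^ (k - 1) * ((k - 1)! : ℝ) ^ 2 * n * ((n - k - 1)! : ℝ) / ((n + k)! : ℝ)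

/-- The kernel `D_{n,k} = (-1)^k k!² (n-k-1)! / (n (n+k)!)` (`n = 0` gives `0` by `1/0 = 0`).
[cite: VanDerPoorten1979Formulae, §1 p. 29-01] -/
def D (n k : ℕ) : ℝ :=
  (-1) ^ k * (k ! : ℝ) ^ 2 * ((n - k - 1)! : ℝ) / (n * ((n + k)! : ℝ))

/-- The kernel `F_{n,k} = ½ (-1)^{n+k} (k-1)!² (n-k)! / (n+k)!`.
[cite: VanDerPoorten1979Formulae, §1 p. 29-01] -/
def F (n k : ℕ) : ℝ :=
  1 / 2 * (-1) ^ (n + k) * ((k - 1)! : ℝ) ^ 2 * ((n - k)! : ℝ) / ((n + k)! : ℝ)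

/-- The kernel `E_{n,k} = ½ (-1)^k (k-1)!² (n-k)! / (k (n+k)!)` (`k = 0` gives `0` by `1/0 = 0`).
[cite: VanDerPoorten1979Formulae, §1 p. 29-01] -/
def E (n k : ℕ) : ℝ :=
  1 / 2 * (-1) ^ k * ((k - 1)! : ℝ) ^ 2 * ((n - k)! : ℝ) / (k * ((n + k)! : ℝ))

/-- `(n+1)! = (n+1) · n!` in `ℝ`. -/
@[folklore] private theorem cast_factorial_succ (n : ℕ) : ((n + 1)! : ℝ) = (n + 1) * (n ! : ℝ) := by
  rw [Nat.factorial_succ]; push_cast; ring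

/-- "`X_{n,k} = D_{n,k-1} - D_{n,k}`" for `1 ≤ k < n`.
[cite: VanDerPoorten1979Formulae, §1 p. 29-01] -/
theorem X_eq_D_sub_D {n k : ℕ} (hk : 1 ≤ k) (hkn : k < n) : X n k = D n (k - 1) - D n k := by
  obtain ⟨j, rfl⟩ : ∃ j, k = j + 1 := ⟨k - 1, by omega⟩
  obtain ⟨m, rfl⟩ : ∃ m, n = j + m + 2 := ⟨n - j - 2, by omega⟩
  have e1 : j + 1 - 1 = j := by omega
  have e2 : j + m + 2 - (j + 1) - 1 = m := by omega
  have e3 : j + m + 2 - j - 1 = m + 1 := by omega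
  have e4 : j + m + 2 + (j + 1) = (j + m + 2 + j) + 1 := by omega
  simp only [X, D, e1, e2, e3, e4, cast_factorial_succ]
  have h1 : ((j + m + 2 + j)! : ℝ) ≠ 0 := by positivity
  have h2 : (j ! : ℝ) ≠ 0 := by positivity
  have h3 : (m ! : ℝ) ≠ 0 := by positivity
  push_cast
  field_simp
  ring

/-- "`(-1)^{n-1} X_{n,k} = F_{n,k} - F_{n-1,k}`" for `1 ≤ k < n`.
[cite: VanDerPoorten1979Formulae, §1 p. 29-01] -/
theorem neg_one_pow_mul_X {n k : ℕ} (hk : 1 ≤ k) (hkn : k < n) :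
    (-1) ^ (n - 1) * X n k = F n k - F (n - 1) k := by
  obtain ⟨j, rfl⟩ : ∃ j, k = j + 1 := ⟨k - 1, by omega⟩
  obtain ⟨m, rfl⟩ : ∃ m, n = j + m + 2 := ⟨n - j - 2, by omega⟩
  have e1 : j + 1 - 1 = j := by omega
  have e3 : j + m + 2 - (j + 1) = m + 1 := by omega
  have e4 : j + m + 2 + (j + 1) = (j + m + 1 + (j + 1)) + 1 := by omega
  have e5 : j + m + 2 - 1 = j + m + 1 := by omega
  have e6 : j + m + 1 - (j + 1) = m := by omega
  simp only [X, F, e1, e3, e4, e5, e6, cast_factorial_succ]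
  have h1 : ((j + m + 1 + (j + 1))! : ℝ) ≠ 0 := by positivity
  have h2 : (j ! : ℝ) ≠ 0 := by positivity
  have h3 : (m ! : ℝ) ≠ 0 := by positivity
  push_cast
  field_simp
  ring

/-- "`(1/n) X_{n,k} = E_{n,k} - E_{n-1,k}`" for `1 ≤ k < n`.
[cite: VanDerPoorten1979Formulae, §1 p. 29-01] -/
theorem X_div {n k : ℕ} (hk : 1 ≤ k) (hkn : k < n) :
    X n k / n = E n k - E (n - 1) k := by
  obtain ⟨j, rfl⟩ : ∃ j, k = j + 1 := ⟨k - 1, by omega⟩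
  obtain ⟨m, rfl⟩ : ∃ m, n = j + m + 2 := ⟨n - j - 2, by omega⟩
  have e1 : j + 1 - 1 = j := by omega
  have e3 : j + m + 2 - (j + 1) = m + 1 := by omega
  have e4 : j + m + 2 + (j + 1) = (j + m + 1 + (j + 1)) + 1 := by omega
  have e5 : j + m + 2 - 1 = j + m + 1 := by omega
  have e6 : j + m + 1 - (j + 1) = m := by omega
  simp only [X, E, e1, e3, e4, e5, e6, cast_factorial_succ]
  have h1 : ((j + m + 1 + (j + 1))! : ℝ) ≠ 0 := by positivity
  have h2 : (j ! : ℝ) ≠ 0 := by positivity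
  have h3 : (m ! : ℝ) ≠ 0 := by positivity
  push_cast
  field_simp
  ring

/-- `(m+1) binom(2m+2,m+1) = 2 (2m+1) binom(2m,m)` in `ℝ` (Mathlib's
`Nat.succ_mul_centralBinom_succ`). -/
@[folklore] private theorem cast_centralBinom_succ (m : ℕ) :
    ((m : ℝ) + 1) * ((m + 1).centralBinom : ℝ) = 2 * (2 * (m : ℝ) + 1) * (m.centralBinom : ℝ) := by
  exact_mod_cast Nat.succ_mul_centralBinom_succ m

/-- `binom(2m,m) · m!² = (2m)!` in `ℝ`. -/
@[folklore] private theorem cast_centralBinom_mul_factorial_sq (m : ℕ) :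
    (m.centralBinom : ℝ) * (m ! : ℝ) ^ 2 = ((2 * m)! : ℝ) := by
  have h := Nat.choose_mul_factorial_mul_factorial (n := 2 * m) (k := m) (by omega)
  rw [show 2 * m - m = m by omega, ← Nat.centralBinom_eq_two_mul_choose] at h
  rw [sq, ← mul_assoc]
  exact_mod_cast h

/-- `D_{n,0} = 1/n²` (`n ≥ 1`): the `k = 0` end of the telescope in `D`.
[cite: VanDerPoorten1979Formulae, §1 p. 29-01 (proof of (1), (2): "the formulae readily follow")] -/
theorem D_zero {n : ℕ} (hn : 1 ≤ n) : D n 0 = 1 / (n : ℝ) ^ 2 := by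
  obtain ⟨m, rfl⟩ : ∃ m, n = m + 1 := ⟨n - 1, by omega⟩
  have e1 : m + 1 - 0 - 1 = m := by omega
  simp only [D, e1, Nat.add_zero, cast_factorial_succ, pow_zero, Nat.factorial_zero]
  have h3 : (m ! : ℝ) ≠ 0 := by positivity
  push_cast
  field_simp

/-- `D_{n,n-1} = 2 (-1)^{n-1} / (n² binom(2n,n))` (`n ≥ 1`): the `k = n - 1` end of the telescope in
`D`, where the central binomial coefficient enters.
[cite: VanDerPoorten1979Formulae, §1 p. 29-01 (proof of (1), (2): "the formulae readily follow")] -/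
theorem D_last {n : ℕ} (hn : 1 ≤ n) :
    D n (n - 1) = 2 * (-1) ^ (n - 1) / ((n : ℝ) ^ 2 * (n.centralBinom : ℝ)) := by
  obtain ⟨m, rfl⟩ : ∃ m, n = m + 1 := ⟨n - 1, by omega⟩
  have e1 : m + 1 - 1 = m := by omega
  have e2 : m + 1 - m - 1 = 0 := by omega
  have e3 : m + 1 + m = 2 * m + 1 := by omega
  simp only [D, e1, e2, e3, cast_factorial_succ, Nat.factorial_zero]
  have hcb := cast_centralBinom_succ m
  have hcb2 := cast_centralBinom_mul_factorial_sq m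
  have h1 : ((2 * m)! : ℝ) ≠ 0 := by positivity
  have h4 : (0 : ℝ) < ((m + 1).centralBinom : ℝ) := Nat.cast_pos.mpr (Nat.centralBinom_pos _)
  rw [div_eq_div_iff (by positivity) (mul_ne_zero (by positivity) h4.ne')]
  push_cast
  linear_combination ((-1 : ℝ) ^ m * (m ! : ℝ) ^ 2 * ((m : ℝ) + 1)) * hcb
    + (2 * (-1 : ℝ) ^ m * ((m : ℝ) + 1) * (2 * (m : ℝ) + 1)) * hcb2

/-- `F_{k,k} = 1 / (2 k² binom(2k,k))` (`k ≥ 1`): the diagonal boundary term of the telescope in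
`F`.
[cite: VanDerPoorten1979Formulae, §1 p. 29-01 (proof of (1), (2): "the formulae readily follow")] -/
theorem F_diag {k : ℕ} (hk : 1 ≤ k) : F k k = 1 / (2 * (k : ℝ) ^ 2 * (k.centralBinom : ℝ)) := by
  obtain ⟨m, rfl⟩ : ∃ m, k = m + 1 := ⟨k - 1, by omega⟩
  have e1 : m + 1 - 1 = m := by omega
  have e2 : m + 1 - (m + 1) = 0 := by omega
  have e3 : m + 1 + (m + 1) = (2 * m + 1) + 1 := by omega
  simp only [F, e1, e2, e3, cast_factorial_succ, Nat.factorial_zero]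
  have hcb := cast_centralBinom_succ m
  have hcb2 := cast_centralBinom_mul_factorial_sq m
  have h1 : ((2 * m)! : ℝ) ≠ 0 := by positivity
  have h4 : (0 : ℝ) < ((m + 1).centralBinom : ℝ) := Nat.cast_pos.mpr (Nat.centralBinom_pos _)
  have h5 : ((-1 : ℝ)) ^ (2 * m + 1 + 1) = 1 := by
    rw [show 2 * m + 1 + 1 = 2 * (m + 1) by ring, pow_mul]; simp
  rw [h5, div_eq_div_iff (by positivity) (mul_ne_zero (by positivity) h4.ne')]
  push_cast
  linear_combination ((m ! : ℝ) ^ 2 * ((m : ℝ) + 1)) * hcb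
    + (2 * ((m : ℝ) + 1) * (2 * (m : ℝ) + 1)) * hcb2

/-- `E_{k,k} = (-1)^k / (2 k³ binom(2k,k))` (`k ≥ 1`): the diagonal boundary term of the telescope
in `E`.
[cite: VanDerPoorten1979Formulae, §1 p. 29-01 (proof of (1), (2): "the formulae readily follow")] -/
theorem E_diag {k : ℕ} (hk : 1 ≤ k) :
    E k k = (-1) ^ k / (2 * (k : ℝ) ^ 3 * (k.centralBinom : ℝ)) := by
  obtain ⟨m, rfl⟩ : ∃ m, k = m + 1 := ⟨k - 1, by omega⟩
  have e1 : m + 1 - 1 = m := by omega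
  have e2 : m + 1 - (m + 1) = 0 := by omega
  have e3 : m + 1 + (m + 1) = (2 * m + 1) + 1 := by omega
  simp only [E, e1, e2, e3, cast_factorial_succ, Nat.factorial_zero]
  have hcb := cast_centralBinom_succ m
  have hcb2 := cast_centralBinom_mul_factorial_sq m
  have h1 : ((2 * m)! : ℝ) ≠ 0 := by positivity
  have h4 : (0 : ℝ) < ((m + 1).centralBinom : ℝ) := Nat.cast_pos.mpr (Nat.centralBinom_pos _)
  rw [div_eq_div_iff (by positivity) (mul_ne_zero (by positivity) h4.ne')]
  push_cast
  linear_combination ((-1 : ℝ) ^ (m + 1) * (m ! : ℝ) ^ 2 * ((m : ℝ) + 1) ^ 2) * hcb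
    + (2 * (-1 : ℝ) ^ (m + 1) * ((m : ℝ) + 1) ^ 2 * (2 * (m : ℝ) + 1)) * hcb2


/-! ## Finite sums -/

/-- Telescoping in `D`: `Σ_{k=1}^{n-1} X_{n,k} = D_{n,0} - D_{n,n-1} = 1/n² - 2(-1)^{n-1}/(n²
binom(2n,n))` (`n ≥ 1`; index `i = k - 1`).
[cite: VanDerPoorten1979Formulae, §1 p. 29-01 (proof of (1), (2): "the formulae readily follow")] -/
theorem sum_X {n : ℕ} (hn : 1 ≤ n) :
    ∑ i ∈ range (n - 1), X n (i + 1) =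
      1 / (n : ℝ) ^ 2 - 2 * (-1) ^ (n - 1) / ((n : ℝ) ^ 2 * (n.centralBinom : ℝ)) := by
  have h : ∀ i ∈ range (n - 1), X n (i + 1) = D n i - D n (i + 1) := by
    intro i hi
    rw [mem_range] at hi
    have := X_eq_D_sub_D (n := n) (k := i + 1) (by omega) (by omega)
    simpa using this
  rw [sum_congr rfl h, sum_range_sub', D_zero hn, D_last hn]

/-- `(-1)^N (-1)^N = 1`. -/
@[folklore] private theorem neg_one_pow_mul_self (N : ℕ) : (-1 : ℝ) ^ N * (-1) ^ N = 1 := by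
  rw [← pow_add, ← two_mul, pow_mul]; simp

/-- Telescoping in `F` over `n ≤ N` (formula (1) at finite level): `Σ_{n=1}^{N} (-1)^{n-1}/n² =
(3/2) Σ_{n=1}^{N} 1/(n² binom(2n,n)) + Σ_{k=1}^{N} F_{N,k}` (indices `i = n - 1`, resp. `i = k -
1`).
[cite: VanDerPoorten1979Formulae, §1 p. 29-01 (proof of (1), (2): "the formulae readily follow")] -/
theorem partialSum_two (N : ℕ) :
    ∑ i ∈ range N, (-1) ^ i / ((i : ℝ) + 1) ^ 2 =
      3 / 2 * ∑ i ∈ range N, 1 / (((i : ℝ) + 1) ^ 2 * ((i + 1).centralBinom : ℝ)) +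
        ∑ i ∈ range N, F N (i + 1) := by
  induction N with
  | zero => simp
  | succ N ih =>
    have hS : ∑ i ∈ range (N + 1), F (N + 1) (i + 1) =
        ∑ i ∈ range N, F N (i + 1) + (-1) ^ N * ∑ i ∈ range N, X (N + 1) (i + 1) +
          F (N + 1) (N + 1) := by
      rw [sum_range_succ, mul_sum, ← sum_add_distrib]
      congr 1
      refine sum_congr rfl fun i hi => ?_
      rw [mem_range] at hi
      have := neg_one_pow_mul_X (n := N + 1) (k := i + 1) (by omega) (by omega)
      simp only [Nat.add_sub_cancel] at this
      linarith
    have hX := sum_X (n := N + 1) (by omega)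
    simp only [Nat.add_sub_cancel] at hX
    rw [hS, sum_range_succ, sum_range_succ, ih, hX, F_diag (by omega : 1 ≤ N + 1)]
    have hcb : (0 : ℝ) < ((N + 1).centralBinom : ℝ) := Nat.cast_pos.mpr (Nat.centralBinom_pos _)
    have hsq := neg_one_pow_mul_self N
    push_cast
    field_simp
    linear_combination (4 : ℝ) * hsq

/-- Telescoping in `E` over `n ≤ N` (formula (2) at finite level): `Σ_{n=1}^{N} 1/n³ = (5/2)
Σ_{n=1}^{N} (-1)^{n-1}/(n³ binom(2n,n)) + Σ_{k=1}^{N} E_{N,k}` (indices `i = n - 1`, resp. `i = k -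
1`).
[cite: VanDerPoorten1979Formulae, §1 p. 29-01 (proof of (1), (2): "the formulae readily follow")] -/
theorem partialSum_three (N : ℕ) :
    ∑ i ∈ range N, 1 / ((i : ℝ) + 1) ^ 3 =
      5 / 2 * ∑ i ∈ range N, (-1) ^ i / (((i : ℝ) + 1) ^ 3 * ((i + 1).centralBinom : ℝ)) +
        ∑ i ∈ range N, E N (i + 1) := by
  induction N with
  | zero => simp
  | succ N ih =>
    have hS : ∑ i ∈ range (N + 1), E (N + 1) (i + 1) =
        ∑ i ∈ range N, E N (i + 1) + (∑ i ∈ range N, X (N + 1) (i + 1)) / (N + 1 : ℕ) +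
          E (N + 1) (N + 1) := by
      rw [sum_range_succ, sum_div, ← sum_add_distrib]
      congr 1
      refine sum_congr rfl fun i hi => ?_
      rw [mem_range] at hi
      have := X_div (n := N + 1) (k := i + 1) (by omega) (by omega)
      simp only [Nat.add_sub_cancel] at this
      linarith
    have hX := sum_X (n := N + 1) (by omega)
    simp only [Nat.add_sub_cancel] at hX
    rw [hS, sum_range_succ, sum_range_succ, ih, hX, E_diag (by omega : 1 ≤ N + 1)]
    have hcb : (0 : ℝ) < ((N + 1).centralBinom : ℝ) := Nat.cast_pos.mpr (Nat.centralBinom_pos _)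
    push_cast
    field_simp
    ring


/-! ## Binomial form of `F`, `E` and the remainder estimate -/

/-- `(k-1)!² (n-k)! · (k² binom(n+k,k) binom(n,k)) = (n+k)!` in `ℝ` for `1 ≤ k ≤ n`. -/
@[folklore] private theorem key_factorial {n k : ℕ} (hk : 1 ≤ k) (hkn : k ≤ n) :
    ((k - 1)! : ℝ) ^ 2 * ((n - k)! : ℝ) * ((k : ℝ) ^ 2 * ((n + k).choose k : ℝ) * (n.choose k : ℝ)) =
      ((n + k)! : ℝ) := by
  obtain ⟨j, rfl⟩ : ∃ j, k = j + 1 := ⟨k - 1, by omega⟩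
  have H1 : (((n + (j + 1)).choose (j + 1) : ℕ) : ℝ) * (((j + 1)! : ℕ) : ℝ) * ((n ! : ℕ) : ℝ) =
      (((n + (j + 1))! : ℕ) : ℝ) := by
    have h := Nat.choose_mul_factorial_mul_factorial (n := n + (j + 1)) (k := j + 1) (by omega)
    rw [Nat.add_sub_cancel] at h
    exact_mod_cast h
  have H2 : ((n.choose (j + 1) : ℕ) : ℝ) * (((j + 1)! : ℕ) : ℝ) * (((n - (j + 1))! : ℕ) : ℝ) =
      ((n ! : ℕ) : ℝ) := by
    exact_mod_cast Nat.choose_mul_factorial_mul_factorial hkn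
  rw [cast_factorial_succ] at H1 H2
  simp only [Nat.add_sub_cancel]
  rw [← H1, ← H2]
  push_cast
  ring

/-- "`F_{n,k} = ½ (-1)^{n+k} / (k² binom(n+k,k) binom(n,k))`" for `1 ≤ k ≤ n`.
[cite: VanDerPoorten1979Formulae, §1 p. 29-01] -/
theorem F_eq_choose {n k : ℕ} (hk : 1 ≤ k) (hkn : k ≤ n) :
    F n k = 1 / 2 * (-1) ^ (n + k) / ((k : ℝ) ^ 2 * ((n + k).choose k : ℝ) * (n.choose k : ℝ)) := by
  have key := key_factorial hk hkn
  have hC1 : (0 : ℝ) < ((n + k).choose k : ℝ) := Nat.cast_pos.mpr (Nat.choose_pos (by omega))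
  have hC2 : (0 : ℝ) < (n.choose k : ℝ) := Nat.cast_pos.mpr (Nat.choose_pos hkn)
  have hkpos : (0 : ℝ) < (k : ℝ) := Nat.cast_pos.mpr (by omega)
  rw [F, div_eq_div_iff (by positivity) (mul_pos (mul_pos (by positivity) hC1) hC2).ne', ← key]
  ring

/-- "`E_{n,k} = ½ (-1)^k / (k³ binom(n+k,k) binom(n,k))`" for `1 ≤ k ≤ n`.
[cite: VanDerPoorten1979Formulae, §1 p. 29-01] -/
theorem E_eq_choose {n k : ℕ} (hk : 1 ≤ k) (hkn : k ≤ n) :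
    E n k = 1 / 2 * (-1) ^ k / ((k : ℝ) ^ 3 * ((n + k).choose k : ℝ) * (n.choose k : ℝ)) := by
  have key := key_factorial hk hkn
  have hC1 : (0 : ℝ) < ((n + k).choose k : ℝ) := Nat.cast_pos.mpr (Nat.choose_pos (by omega))
  have hC2 : (0 : ℝ) < (n.choose k : ℝ) := Nat.cast_pos.mpr (Nat.choose_pos hkn)
  have hkpos : (0 : ℝ) < (k : ℝ) := Nat.cast_pos.mpr (by omega)
  rw [E, div_eq_div_iff (by positivity) (mul_pos (mul_pos (by positivity) hC1) hC2).ne']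
  linear_combination (1 / 2 * (-1 : ℝ) ^ k * (k : ℝ)) * key

/-- `n + 1 ≤ binom(n+k,k)` for `k ≥ 1`. -/
@[folklore] private theorem succ_le_cast_choose {n k : ℕ} (hk : 1 ≤ k) :
    (n : ℝ) + 1 ≤ ((n + k).choose k : ℝ) := by
  have h1 : (n + 1).choose n ≤ (n + k).choose n := Nat.choose_le_choose n (by omega)
  rw [Nat.choose_succ_self_right, Nat.choose_symm_add] at h1
  exact_mod_cast h1

/-- `|F_{n,k}| ≤ 1 / (2 k² (n+1))` for `1 ≤ k ≤ n` (from `binom(n+k,k) ≥ n+1`, `binom(n,k) ≥ 1`):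
the boundary terms of the `F`-telescope are small.
[cite: VanDerPoorten1979Formulae, §1 p. 29-01 (proof of (1), (2): "the formulae readily follow")] -/
theorem abs_F_le {n k : ℕ} (hk : 1 ≤ k) (hkn : k ≤ n) :
    |F n k| ≤ 1 / (2 * (k : ℝ) ^ 2 * ((n : ℝ) + 1)) := by
  have hC1 := succ_le_cast_choose (n := n) hk
  have hC2 : (1 : ℝ) ≤ (n.choose k : ℝ) := by exact_mod_cast Nat.choose_pos hkn
  have hkpos : (0 : ℝ) < (k : ℝ) := Nat.cast_pos.mpr (by omega)
  have hprod : (n : ℝ) + 1 ≤ ((n + k).choose k : ℝ) * (n.choose k : ℝ) := by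
    calc (n : ℝ) + 1 = ((n : ℝ) + 1) * 1 := by ring
      _ ≤ ((n + k).choose k : ℝ) * (n.choose k : ℝ) :=
          mul_le_mul hC1 hC2 zero_le_one (by positivity)
  have hC1pos : (0 : ℝ) < ((n + k).choose k : ℝ) := lt_of_lt_of_le (by positivity) hC1
  have hC2pos : (0 : ℝ) < (n.choose k : ℝ) := lt_of_lt_of_le (by norm_num) hC2
  have hden : (0 : ℝ) < (k : ℝ) ^ 2 * ((n + k).choose k : ℝ) * (n.choose k : ℝ) :=
    mul_pos (mul_pos (by positivity) hC1pos) hC2pos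
  rw [F_eq_choose hk hkn, abs_div, abs_mul, abs_pow, abs_neg, abs_one, one_pow, mul_one,
    abs_of_pos (by norm_num : (0 : ℝ) < 1 / 2), abs_of_pos hden,
    div_le_div_iff₀ hden (by positivity)]
  nlinarith [mul_le_mul_of_nonneg_left hprod (sq_nonneg (k : ℝ))]

/-- `|E_{n,k}| ≤ 1 / (2 k² (n+1))` for `1 ≤ k ≤ n`.
[cite: VanDerPoorten1979Formulae, §1 p. 29-01 (proof of (1), (2): "the formulae readily follow")] -/
theorem abs_E_le {n k : ℕ} (hk : 1 ≤ k) (hkn : k ≤ n) :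
    |E n k| ≤ 1 / (2 * (k : ℝ) ^ 2 * ((n : ℝ) + 1)) := by
  have hC1 := succ_le_cast_choose (n := n) hk
  have hC2 : (1 : ℝ) ≤ (n.choose k : ℝ) := by exact_mod_cast Nat.choose_pos hkn
  have hk1 : (1 : ℝ) ≤ (k : ℝ) := by exact_mod_cast hk
  have hprod : (n : ℝ) + 1 ≤ (k : ℝ) * (((n + k).choose k : ℝ) * (n.choose k : ℝ)) := by
    calc (n : ℝ) + 1 = 1 * (((n : ℝ) + 1) * 1) := by ring
      _ ≤ (k : ℝ) * (((n + k).choose k : ℝ) * (n.choose k : ℝ)) :=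
          mul_le_mul hk1 (mul_le_mul hC1 hC2 zero_le_one (by positivity)) (by positivity)
            (by positivity)
  have hC1pos : (0 : ℝ) < ((n + k).choose k : ℝ) := lt_of_lt_of_le (by positivity) hC1
  have hC2pos : (0 : ℝ) < (n.choose k : ℝ) := lt_of_lt_of_le (by norm_num) hC2
  have hden : (0 : ℝ) < (k : ℝ) ^ 3 * ((n + k).choose k : ℝ) * (n.choose k : ℝ) :=
    mul_pos (mul_pos (by positivity) hC1pos) hC2pos
  rw [E_eq_choose hk hkn, abs_div, abs_mul, abs_pow, abs_neg, abs_one, one_pow, mul_one,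
    abs_of_pos (by norm_num : (0 : ℝ) < 1 / 2), abs_of_pos hden,
    div_le_div_iff₀ hden (by positivity)]
  nlinarith [mul_le_mul_of_nonneg_left hprod (sq_nonneg (k : ℝ))]

/-- `Σ_{i<N} 1/(i+1)² ≤ 2` (comparison with the telescoping `Σ 1/(i(i+1))`). -/
@[folklore] private theorem sum_inv_sq_le (N : ℕ) : ∑ i ∈ range N, 1 / ((i : ℝ) + 1) ^ 2 ≤ 2 := by
  suffices h : ∀ M : ℕ, 1 ≤ M → ∑ i ∈ range M, 1 / ((i : ℝ) + 1) ^ 2 ≤ 2 - 1 / (M : ℝ) by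
    rcases Nat.eq_zero_or_pos N with h0 | hpos
    · subst h0; simp
    · have h1 := h N hpos
      have h2 : (0 : ℝ) ≤ 1 / (N : ℝ) := by positivity
      linarith
  intro M hM
  induction M, hM using Nat.le_induction with
  | base => norm_num
  | succ M hM ih =>
    rw [sum_range_succ]
    have hM' : (1 : ℝ) ≤ M := by exact_mod_cast hM
    have key : 1 / ((M : ℝ) + 1) ^ 2 ≤ 1 / (M : ℝ) - 1 / ((M : ℝ) + 1) := by
      rw [div_sub_div _ _ (by positivity) (by positivity),
        div_le_div_iff₀ (by positivity) (by positivity)]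
      nlinarith
    push_cast
    linarith

/-- The boundary sum of the `F`-telescope is `O(1/N)`: `|Σ_{k=1}^{N} F_{N,k}| ≤ 1/(N+1)`.
[cite: VanDerPoorten1979Formulae, §1 p. 29-01 (proof of (1), (2): "the formulae readily follow")] -/
theorem abs_sum_F_le (N : ℕ) : |∑ i ∈ range N, F N (i + 1)| ≤ 1 / ((N : ℝ) + 1) := by
  calc |∑ i ∈ range N, F N (i + 1)| ≤ ∑ i ∈ range N, |F N (i + 1)| := abs_sum_le_sum_abs _ _
    _ ≤ ∑ i ∈ range N, 1 / (2 * ((i : ℝ) + 1) ^ 2 * ((N : ℝ) + 1)) := by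
        refine sum_le_sum fun i hi => ?_
        rw [mem_range] at hi
        have := abs_F_le (n := N) (k := i + 1) (by omega) (by omega)
        push_cast at this
        exact this
    _ = (∑ i ∈ range N, 1 / ((i : ℝ) + 1) ^ 2) * (1 / (2 * ((N : ℝ) + 1))) := by
        rw [sum_mul]
        refine sum_congr rfl fun i _ => ?_
        rw [one_div_mul_one_div]
        congr 1
        ring
    _ ≤ 2 * (1 / (2 * ((N : ℝ) + 1))) := by gcongr; exact sum_inv_sq_le N
    _ = 1 / ((N : ℝ) + 1) := by field_simp

/-- The boundary sum of the `E`-telescope is `O(1/N)`: `|Σ_{k=1}^{N} E_{N,k}| ≤ 1/(N+1)`.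
[cite: VanDerPoorten1979Formulae, §1 p. 29-01 (proof of (1), (2): "the formulae readily follow")] -/
theorem abs_sum_E_le (N : ℕ) : |∑ i ∈ range N, E N (i + 1)| ≤ 1 / ((N : ℝ) + 1) := by
  calc |∑ i ∈ range N, E N (i + 1)| ≤ ∑ i ∈ range N, |E N (i + 1)| := abs_sum_le_sum_abs _ _
    _ ≤ ∑ i ∈ range N, 1 / (2 * ((i : ℝ) + 1) ^ 2 * ((N : ℝ) + 1)) := by
        refine sum_le_sum fun i hi => ?_
        rw [mem_range] at hi
        have := abs_E_le (n := N) (k := i + 1) (by omega) (by omega)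
        push_cast at this
        exact this
    _ = (∑ i ∈ range N, 1 / ((i : ℝ) + 1) ^ 2) * (1 / (2 * ((N : ℝ) + 1))) := by
        rw [sum_mul]
        refine sum_congr rfl fun i _ => ?_
        rw [one_div_mul_one_div]
        congr 1
        ring
    _ ≤ 2 * (1 / (2 * ((N : ℝ) + 1))) := by gcongr; exact sum_inv_sq_le N
    _ = 1 / ((N : ℝ) + 1) := by field_simp

/-- `Σ_{k=1}^{N} F_{N,k} → 0` as `N → ∞`.
[cite: VanDerPoorten1979Formulae, §1 p. 29-01 (proof of (1), (2): "the formulae readily follow")] -/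
theorem tendsto_sum_F : Tendsto (fun N => ∑ i ∈ range N, F N (i + 1)) atTop (𝓝 0) :=
  squeeze_zero_norm (fun N => (Real.norm_eq_abs _).le.trans (abs_sum_F_le N))
    tendsto_one_div_add_atTop_nhds_zero_nat

/-- `Σ_{k=1}^{N} E_{N,k} → 0` as `N → ∞`.
[cite: VanDerPoorten1979Formulae, §1 p. 29-01 (proof of (1), (2): "the formulae readily follow")] -/
theorem tendsto_sum_E : Tendsto (fun N => ∑ i ∈ range N, E N (i + 1)) atTop (𝓝 0) :=
  squeeze_zero_norm (fun N => (Real.norm_eq_abs _).le.trans (abs_sum_E_le N))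
    tendsto_one_div_add_atTop_nhds_zero_nat

/-! ## The limits of the left-hand sides -/

/-- `Σ_{n ≥ 1} (-1)^{n+1}/n² = π²/12` (`= ζ(2)/2`; the `n = 0` term is `0` by `1/0 = 0`), from
Mathlib's `hasSum_zeta_two` by splitting into even and odd `n`. -/
@[folklore] private theorem hasSum_neg_one_pow_div_sq :
    HasSum (fun n : ℕ => (-1) ^ (n + 1) / (n : ℝ) ^ 2) (π ^ 2 / 12) := by
  set f : ℕ → ℝ := fun n => 1 / (n : ℝ) ^ 2 with hf
  set g : ℕ → ℝ := fun n => (-1) ^ (n + 1) / (n : ℝ) ^ 2 with hg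
  have hF : HasSum f (π ^ 2 / 6) := hasSum_zeta_two
  have h_even : HasSum (fun k => f (2 * k)) (π ^ 2 / 24) := by
    have e : (fun k => f (2 * k)) = fun k => 1 / 4 * f k := by
      funext k; simp only [hf]; push_cast; ring
    rw [e, show (π : ℝ) ^ 2 / 24 = 1 / 4 * (π ^ 2 / 6) by ring]
    exact hF.mul_left (1 / 4)
  have h_odd : HasSum (fun k => f (2 * k + 1)) (π ^ 2 / 8) := by
    have hs : Summable (fun k => f (2 * k + 1)) :=
      hF.summable.comp_injective (i := fun k => 2 * k + 1) fun a b h => by simpa using h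
    obtain ⟨b, hb⟩ := hs
    have h := HasSum.even_add_odd h_even hb
    have hb' : b = π ^ 2 / 8 := by
      have := h.unique hF
      linarith
    rwa [hb'] at hb
  have he : HasSum (fun k => g (2 * k)) (-(π ^ 2 / 24)) := by
    have e : (fun k => g (2 * k)) = fun k => -f (2 * k) := by
      funext k
      simp only [hg, hf]
      rw [pow_succ, pow_mul]
      simp
      ring
    rw [e]
    exact h_even.neg
  have ho : HasSum (fun k => g (2 * k + 1)) (π ^ 2 / 8) := by
    have e : (fun k => g (2 * k + 1)) = fun k => f (2 * k + 1) := by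
      funext k
      simp only [hg, hf]
      rw [show 2 * k + 1 + 1 = 2 * (k + 1) by ring, pow_mul]
      simp
    rw [e]
    exact h_odd
  rw [show (π : ℝ) ^ 2 / 12 = -(π ^ 2 / 24) + π ^ 2 / 8 by ring]
  exact HasSum.even_add_odd he ho

/-- Shifted index: `Σ_{i ≥ 0} (-1)^i/(i+1)² = π²/12`. -/
@[folklore] private theorem hasSum_neg_one_pow_div_sq_succ :
    HasSum (fun i : ℕ => (-1) ^ i / ((i : ℝ) + 1) ^ 2) (π ^ 2 / 12) := by
  have h := (hasSum_nat_add_iff' (f := fun n : ℕ => (-1 : ℝ) ^ (n + 1) / (n : ℝ) ^ 2) 1).mpr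
    hasSum_neg_one_pow_div_sq
  beta_reduce at h
  have hv : π ^ 2 / 12 - ∑ i ∈ range 1, (-1 : ℝ) ^ (i + 1) / (i : ℝ) ^ 2 = π ^ 2 / 12 := by simp
  rw [hv] at h
  exact h.congr_fun fun i => by push_cast; ring

/-- Shifted index: `Σ_{i ≥ 0} 1/(i+1)³ = ζ(3) = zetaValue 3` (`= Σ_n 1/n³`, the `n = 0` term being
`0`). -/
@[folklore] private theorem hasSum_one_div_cube_succ :
    HasSum (fun i : ℕ => 1 / ((i : ℝ) + 1) ^ 3) (zetaValue 3) := by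
  unfold zetaValue
  have hs : Summable (fun n : ℕ => 1 / (n : ℝ) ^ 3) :=
    Real.summable_one_div_nat_pow.mpr (by norm_num)
  have h := (hasSum_nat_add_iff' (f := fun n : ℕ => 1 / (n : ℝ) ^ 3) 1).mpr hs.hasSum
  beta_reduce at h
  have hv : ∑' n : ℕ, 1 / (n : ℝ) ^ 3 - ∑ i ∈ range 1, 1 / (i : ℝ) ^ 3 = ∑' n : ℕ, 1 / (n : ℝ) ^ 3 := by
    simp
  rw [hv] at h
  exact h.congr_fun fun i => by push_cast; ring


/-! ## The general term `1/(n^p binom(2n,n))` -/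

/-- The general term `a_p(n) = 1 / (n^p binom(2n,n))` of the series in (1)–(4) (`a_p(0) = 0` for `p
≥ 1` by `1/0 = 0`). [cite: VanDerPoorten1979Formulae, §1 (1)–(4)] -/
def binomTerm (p n : ℕ) : ℝ := 1 / ((n : ℝ) ^ p * (n.centralBinom : ℝ))

/-- `a_p(0) = 0` for `p ≥ 1`. -/
@[folklore] private theorem binomTerm_zero {p : ℕ} (hp : 1 ≤ p) : binomTerm p 0 = 0 := by
  simp [binomTerm, zero_pow (by omega : p ≠ 0)]

/-- `0 ≤ a_p(n)`. -/
@[folklore] private theorem binomTerm_nonneg (p n : ℕ) : 0 ≤ binomTerm p n := by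
  unfold binomTerm; positivity

/-- `0 < a_p(n)` for `n ≥ 1`. -/
@[folklore] private theorem binomTerm_pos (p : ℕ) {n : ℕ} (hn : 1 ≤ n) : 0 < binomTerm p n := by
  unfold binomTerm
  have h1 : (0 : ℝ) < (n.centralBinom : ℝ) := Nat.cast_pos.mpr (Nat.centralBinom_pos n)
  have h2 : (0 : ℝ) < (n : ℝ) := Nat.cast_pos.mpr (by omega)
  positivity

/-- `a_p(n+1) ≤ 1/(n+1)^p` (since `binom(2n+2,n+1) ≥ 1`). -/
@[folklore] private theorem binomTerm_succ_le_one_div_pow (p n : ℕ) :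
    binomTerm p (n + 1) ≤ 1 / ((n : ℝ) + 1) ^ p := by
  have hcb : (1 : ℝ) ≤ ((n + 1).centralBinom : ℝ) := by
    exact_mod_cast Nat.centralBinom_pos (n + 1)
  unfold binomTerm
  push_cast
  exact one_div_le_one_div_of_le (by positivity) (le_mul_of_one_le_right (by positivity) hcb)

/-! ## Formula (1): `ζ(2) = π²/6 = 3 Σ_{n ≥ 1} 1/(n² binom(2n,n))` -/

/-- Formula (1) in the shifted index `i = n - 1`: `Σ_{i ≥ 0} 1/((i+1)² binom(2i+2,i+1)) = π²/18`
(limit of `partialSum_two`: `(2/3) · (π²/12 - 0)`). [cite: VanDerPoorten1979Formulae, §1 (1)] -/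
theorem hasSum_binomTerm_two_succ :
    HasSum (fun i : ℕ => binomTerm 2 (i + 1)) (π ^ 2 / 18) := by
  have hA : ∀ N, ∑ i ∈ range N, binomTerm 2 (i + 1) =
      2 / 3 * (∑ i ∈ range N, (-1) ^ i / ((i : ℝ) + 1) ^ 2 - ∑ i ∈ range N, F N (i + 1)) := by
    intro N
    have h := partialSum_two N
    have e : ∑ i ∈ range N, binomTerm 2 (i + 1) =
        ∑ i ∈ range N, 1 / (((i : ℝ) + 1) ^ 2 * ((i + 1).centralBinom : ℝ)) :=
      sum_congr rfl fun i _ => by simp [binomTerm]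
    rw [e]
    linarith
  have hlim : Tendsto (fun N => ∑ i ∈ range N, binomTerm 2 (i + 1)) atTop (𝓝 (π ^ 2 / 18)) := by
    have h := ((hasSum_neg_one_pow_div_sq_succ.tendsto_sum_nat).sub tendsto_sum_F).const_mul
      (2 / 3 : ℝ)
    rw [show (π : ℝ) ^ 2 / 18 = 2 / 3 * (π ^ 2 / 12 - 0) by ring]
    exact h.congr fun N => (hA N).symm
  exact (hasSum_iff_tendsto_nat_of_nonneg (fun i => binomTerm_nonneg 2 (i + 1)) _).mpr hlim

/-- Formula (1), `HasSum` form: `Σ_n 1/(n² binom(2n,n)) = π²/18` (`n = 0` term `= 0`).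
[cite: VanDerPoorten1979Formulae, §1 (1)] -/
theorem hasSum_binomTerm_two : HasSum (binomTerm 2) (π ^ 2 / 18) := by
  have h := hasSum_binomTerm_two_succ.zero_add (f := binomTerm 2)
  rwa [binomTerm_zero (by norm_num), zero_add] at h

/-- **Formula (1)**: "`ζ(2) = π²/6 = 3 Σ₁^∞ 1/(n² binom(2n,n))`".
[cite: VanDerPoorten1979Formulae, §1 (1)] -/
theorem pi_sq_div_six_eq_three_mul_tsum_binomTerm : π ^ 2 / 6 = 3 * ∑' n : ℕ, binomTerm 2 n := by
  rw [hasSum_binomTerm_two.tsum_eq]; ring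

/-- **Formula (1)** with the real series `ζ(2) = Σ₁^∞ 1/n²` (the tree's `zetaValue 2`) on the left:
"`Σ₁^∞ 1/n² = 3 Σ₁^∞ 1/(n² binom(2n,n))`" (`n = 0` terms `= 0`).
[cite: VanDerPoorten1979Formulae, §1 (1)] -/
theorem zetaValue_two_eq_three_mul_tsum :
    zetaValue 2 = 3 * ∑' n : ℕ, 1 / ((n : ℝ) ^ 2 * (n.centralBinom : ℝ)) := by
  rw [zetaValue, hasSum_zeta_two.tsum_eq, pi_sq_div_six_eq_three_mul_tsum_binomTerm]
  rfl

/-- **Formula (1)** for Mathlib's Riemann zeta function: `ζ(2) = 3 Σ₁^∞ 1/(n² binom(2n,n))` in `ℂ`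
(`n = 0` term `= 0`). [cite: VanDerPoorten1979Formulae, §1 (1)] -/
theorem riemannZeta_two_eq_three_mul_tsum :
    riemannZeta 2 = 3 * ∑' n : ℕ, 1 / ((n : ℂ) ^ 2 * (n.centralBinom : ℂ)) := by
  have h : (((π ^ 2 / 6 : ℝ)) : ℂ) = ((3 * ∑' n : ℕ, binomTerm 2 n : ℝ) : ℂ) := by
    rw [pi_sq_div_six_eq_three_mul_tsum_binomTerm]
  rw [riemannZeta_two, show (π : ℂ) ^ 2 / 6 = (((π ^ 2 / 6 : ℝ)) : ℂ) by push_cast; ring, h,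
    Complex.ofReal_mul, Complex.ofReal_tsum]
  congr 1
  exact tsum_congr fun n => by unfold binomTerm; push_cast; ring

/-! ## Formula (2): `ζ(3) = (5/2) Σ_{n ≥ 1} (-1)^{n-1}/(n³ binom(2n,n))` -/

/-- Formula (2) in the shifted index `i = n - 1`: `Σ_{i ≥ 0} (-1)^i/((i+1)³ binom(2i+2,i+1)) = (2/5)
ζ(3)` (`ζ(3) = zetaValue 3 = Σ_n 1/n³`; limit of `partialSum_three`: `(2/5) · (ζ(3) - 0)`).
[cite: VanDerPoorten1979Formulae, §1 (2)] -/
theorem hasSum_alt_binomTerm_three_succ :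
    HasSum (fun i : ℕ => (-1) ^ i * binomTerm 3 (i + 1)) (2 / 5 * zetaValue 3) := by
  have hA : ∀ N, ∑ i ∈ range N, (-1) ^ i * binomTerm 3 (i + 1) =
      2 / 5 * (∑ i ∈ range N, 1 / ((i : ℝ) + 1) ^ 3 - ∑ i ∈ range N, E N (i + 1)) := by
    intro N
    have h := partialSum_three N
    have e : ∑ i ∈ range N, (-1) ^ i * binomTerm 3 (i + 1) =
        ∑ i ∈ range N, (-1) ^ i / (((i : ℝ) + 1) ^ 3 * ((i + 1).centralBinom : ℝ)) :=
      sum_congr rfl fun i _ => by unfold binomTerm; push_cast; rw [mul_one_div]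
    rw [e]
    linarith
  have hlim : Tendsto (fun N => ∑ i ∈ range N, (-1) ^ i * binomTerm 3 (i + 1)) atTop
      (𝓝 (2 / 5 * zetaValue 3)) := by
    have h := ((hasSum_one_div_cube_succ.tendsto_sum_nat).sub tendsto_sum_E).const_mul (2 / 5 : ℝ)
    rw [show (2 / 5 : ℝ) * zetaValue 3 = 2 / 5 * (zetaValue 3 - 0) by ring]
    exact h.congr fun N => (hA N).symm
  have hs : Summable (fun i : ℕ => (-1) ^ i * binomTerm 3 (i + 1)) := by
    refine Summable.of_norm_bounded hasSum_one_div_cube_succ.summable fun i => ?_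
    rw [norm_mul, norm_pow, norm_neg, norm_one, one_pow, one_mul,
      Real.norm_of_nonneg (binomTerm_nonneg _ _)]
    exact binomTerm_succ_le_one_div_pow 3 i
  have h2 := hs.hasSum
  rwa [tendsto_nhds_unique h2.tendsto_sum_nat hlim] at h2

/-- Formula (2), `HasSum` form: `Σ_n (-1)^{n-1}/(n³ binom(2n,n)) = (2/5) ζ(3)` (`n = 0` term `= 0`;
`ζ(3) = zetaValue 3`). [cite: VanDerPoorten1979Formulae, §1 (2)] -/
theorem hasSum_alt_binomTerm_three :
    HasSum (fun n : ℕ => (-1) ^ (n - 1) * binomTerm 3 n) (2 / 5 * zetaValue 3) := by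
  have h := hasSum_alt_binomTerm_three_succ
  have h1 : HasSum (fun i : ℕ => (-1 : ℝ) ^ (i + 1 - 1) * binomTerm 3 (i + 1))
      (2 / 5 * zetaValue 3) :=
    h.congr_fun fun i => by rw [Nat.add_sub_cancel]
  have h2 := HasSum.zero_add (f := fun n : ℕ => (-1 : ℝ) ^ (n - 1) * binomTerm 3 n) h1
  rw [binomTerm_zero (by norm_num), mul_zero, zero_add] at h2
  exact h2

/-- **Formula (2)**: "`ζ(3) = Σ₁^∞ 1/n³ = (5/2) Σ₁^∞ (-1)^{n-1}/(n³ binom(2n,n))`" with the real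
series `ζ(3) = Σ₁^∞ 1/n³` = the tree's `zetaValue 3` (`n = 0` terms `= 0`).
[cite: VanDerPoorten1979Formulae, §1 (2)] -/
theorem zetaValue_three_eq :
    zetaValue 3 = 5 / 2 * ∑' n : ℕ, (-1) ^ (n - 1) / ((n : ℝ) ^ 3 * (n.centralBinom : ℝ)) := by
  have e : (fun n : ℕ => (-1 : ℝ) ^ (n - 1) / ((n : ℝ) ^ 3 * (n.centralBinom : ℝ))) =
      fun n : ℕ => (-1) ^ (n - 1) * binomTerm 3 n := by
    funext n; unfold binomTerm; exact div_eq_mul_one_div _ _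
  rw [e, hasSum_alt_binomTerm_three.tsum_eq]
  ring

/-- **Formula (2)** for Mathlib's Riemann zeta function: `ζ(3) = (5/2) Σ₁^∞ (-1)^{n-1}/(n³
binom(2n,n))` in `ℂ` (`n = 0` term `= 0`). [cite: VanDerPoorten1979Formulae, §1 (2)] -/
theorem riemannZeta_three_eq :
    riemannZeta 3 = 5 / 2 * ∑' n : ℕ, (-1) ^ (n - 1) / ((n : ℂ) ^ 3 * (n.centralBinom : ℂ)) := by
  have hz : riemannZeta 3 = ((zetaValue 3 : ℝ) : ℂ) := by
    rw [ofReal_zetaValue (by norm_num)]; norm_num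
  rw [hz, zetaValue_three_eq, Complex.ofReal_mul, Complex.ofReal_tsum]
  congr 1 <;> first
    | exact tsum_congr fun n => by push_cast; ring
    | norm_num

/-! ## Term ratio and tails (the truncation bounds used with (1) and (2)) -/

/-- `4 n^p binom(2n,n) ≤ (n+1)^p binom(2n+2,n+1)` for `p ≥ 1`: the term ratio of `Σ 1/(n^p
binom(2n,n))` is at most `1/4` (`binom(2n+2,n+1)/binom(2n,n) = 2(2n+1)/(n+1)`). -/
@[folklore] private theorem four_mul_pow_mul_centralBinom_le {p : ℕ} (hp : 1 ≤ p) (n : ℕ) :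
    4 * ((n : ℝ) ^ p * (n.centralBinom : ℝ)) ≤ ((n : ℝ) + 1) ^ p * ((n + 1).centralBinom : ℝ) := by
  obtain ⟨q, rfl⟩ : ∃ q, p = q + 1 := ⟨p - 1, by omega⟩
  have hcb := cast_centralBinom_succ n
  have h1 : (n : ℝ) ^ q ≤ ((n : ℝ) + 1) ^ q := pow_le_pow_left₀ (by positivity) (by linarith) q
  have h2 : (4 : ℝ) * n ≤ 2 * (2 * n + 1) := by linarith
  calc 4 * ((n : ℝ) ^ (q + 1) * (n.centralBinom : ℝ))
      = (n : ℝ) ^ q * (4 * n) * (n.centralBinom : ℝ) := by ring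
    _ ≤ ((n : ℝ) + 1) ^ q * (2 * (2 * n + 1)) * (n.centralBinom : ℝ) :=
        mul_le_mul_of_nonneg_right (mul_le_mul h1 h2 (by positivity) (by positivity))
          (by positivity)
    _ = ((n : ℝ) + 1) ^ q * (((n : ℝ) + 1) * ((n + 1).centralBinom : ℝ)) := by rw [hcb]; ring
    _ = ((n : ℝ) + 1) ^ (q + 1) * ((n + 1).centralBinom : ℝ) := by ring

/-- Term ratio: `a_p(n+1) ≤ a_p(n)/4` for `n, p ≥ 1`. -/
@[folklore] private theorem binomTerm_succ_le {p n : ℕ} (hp : 1 ≤ p) (hn : 1 ≤ n) :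
    binomTerm p (n + 1) ≤ binomTerm p n / 4 := by
  have h4 := four_mul_pow_mul_centralBinom_le hp n
  have hpos : (0 : ℝ) < (n : ℝ) ^ p * (n.centralBinom : ℝ) := by
    have := binomTerm_pos p hn
    unfold binomTerm at this
    exact one_div_pos.mp this
  unfold binomTerm
  push_cast
  calc 1 / (((n : ℝ) + 1) ^ p * ((n + 1).centralBinom : ℝ))
      ≤ 1 / (4 * ((n : ℝ) ^ p * (n.centralBinom : ℝ))) :=
        one_div_le_one_div_of_le (mul_pos (by norm_num) hpos) h4
    _ = 1 / ((n : ℝ) ^ p * (n.centralBinom : ℝ)) / 4 := by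
        rw [div_div, mul_comm (4 : ℝ)]

/-- The terms decrease: `a_p(n+1) ≤ a_p(n)` for `n, p ≥ 1`. -/
@[folklore] private theorem binomTerm_succ_le_self {p n : ℕ} (hp : 1 ≤ p) (hn : 1 ≤ n) :
    binomTerm p (n + 1) ≤ binomTerm p n :=
  (binomTerm_succ_le hp hn).trans (by have := binomTerm_nonneg p n; linarith)

/-- Geometric domination of the tail: `a_p(K+1+i) ≤ a_p(K)/4^{i+1}` for `K, p ≥ 1`. -/
@[folklore] private theorem binomTerm_tail_term_le {p K : ℕ} (hp : 1 ≤ p) (hK : 1 ≤ K) (i : ℕ) :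
    binomTerm p (i + K + 1) ≤ binomTerm p K / 4 ^ (i + 1) := by
  induction i with
  | zero => simpa using binomTerm_succ_le hp hK
  | succ i ih =>
    calc binomTerm p (i + 1 + K + 1) = binomTerm p (i + K + 1 + 1) := by
          rw [show i + 1 + K + 1 = i + K + 1 + 1 by ring]
      _ ≤ binomTerm p (i + K + 1) / 4 := binomTerm_succ_le hp (by omega)
      _ ≤ binomTerm p K / 4 ^ (i + 1) / 4 := by gcongr
      _ = binomTerm p K / 4 ^ (i + 1 + 1) := by rw [div_div, ← pow_succ]

/-- The tail after the last kept term is at most a third of it: `Σ_{n > K} 1/(n^p binom(2n,n)) ≤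
(1/3) · 1/(K^p binom(2K,K))` for `K, p ≥ 1` (term ratio `≤ 1/4`, `Σ_{j ≥ 1} 4^{-j} = 1/3`). -/
@[folklore] private theorem tsum_binomTerm_tail_le {p K : ℕ} (hp : 1 ≤ p) (hK : 1 ≤ K) :
    ∑' i : ℕ, binomTerm p (i + K + 1) ≤ binomTerm p K / 3 := by
  have hgeom : HasSum (fun i : ℕ => binomTerm p K / 4 ^ (i + 1)) (binomTerm p K / 3) := by
    have h := (hasSum_geometric_of_lt_one (by norm_num : (0 : ℝ) ≤ 1 / 4)
      (by norm_num : (1 / 4 : ℝ) < 1)).mul_left (binomTerm p K / 4)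
    rw [show binomTerm p K / 3 = binomTerm p K / 4 * (1 - 1 / 4)⁻¹ by ring]
    exact h.congr_fun fun i => by rw [one_div_pow]; ring
  have hsum : Summable (fun i : ℕ => binomTerm p (i + K + 1)) :=
    Summable.of_nonneg_of_le (fun i => binomTerm_nonneg _ _) (binomTerm_tail_term_le hp hK)
      hgeom.summable
  exact hasSum_le (binomTerm_tail_term_le hp hK) hsum.hasSum hgeom

/-- Truncating (1): for `K ≥ 1`, `3 Σ_{n=1}^{K} a_2(n) < π²/6 ≤ 3 Σ_{n=1}^{K} a_2(n) + a_2(K)`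
(index `i = n - 1`; (1) combined with the elementary tail bound `tsum_binomTerm_tail_le` — the
truncation itself is not printed in the source).
[cite: VanDerPoorten1979Formulae, §1 (1) (use: truncation)] -/
theorem pi_sq_div_six_mem_Ioc {K : ℕ} (hK : 1 ≤ K) :
    3 * ∑ i ∈ range K, binomTerm 2 (i + 1) < π ^ 2 / 6 ∧
      π ^ 2 / 6 ≤ 3 * ∑ i ∈ range K, binomTerm 2 (i + 1) + binomTerm 2 K := by
  have hs := hasSum_binomTerm_two_succ.summable
  have hsplit := hs.sum_add_tsum_nat_add K
  rw [hasSum_binomTerm_two_succ.tsum_eq] at hsplit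
  have htail := tsum_binomTerm_tail_le (p := 2) (by norm_num) hK
  have htail_pos : 0 < ∑' i : ℕ, binomTerm 2 (i + K + 1) :=
    ((summable_nat_add_iff K).mpr hs).tsum_pos (fun i => binomTerm_nonneg _ _) 0
      (binomTerm_pos 2 (by omega))
  constructor <;> linarith

/-- Truncating (2): for every `K`, `|ζ(3) - (5/2) Σ_{n=1}^{K} (-1)^{n-1} a_3(n)| ≤ (5/2) a_3(K+1)`
(index `i = n - 1`; (2) with the alternating-series bound, Mathlib's
`alternating_series_error_bound`; `ζ(3) = zetaValue 3`; the truncation itself is not printed in the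
source). [cite: VanDerPoorten1979Formulae, §1 (2) (use: truncation)] -/
theorem abs_zetaValue_three_sub_partialSum_le (K : ℕ) :
    |zetaValue 3 - 5 / 2 * ∑ i ∈ range K, (-1) ^ i * binomTerm 3 (i + 1)| ≤
      5 / 2 * binomTerm 3 (K + 1) := by
  have hanti : Antitone (fun i : ℕ => binomTerm 3 (i + 1)) :=
    antitone_nat_of_succ_le fun i => binomTerm_succ_le_self (p := 3) (by norm_num) (by omega)
  have hs : Summable (fun i : ℕ => binomTerm 3 (i + 1)) :=
    Summable.of_nonneg_of_le (fun i => binomTerm_nonneg _ _) (binomTerm_succ_le_one_div_pow 3)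
      hasSum_one_div_cube_succ.summable
  have herr := alternating_series_error_bound (fun i : ℕ => binomTerm 3 (i + 1)) hanti hs K
  beta_reduce at herr
  rw [hasSum_alt_binomTerm_three_succ.tsum_eq] at herr
  rw [show zetaValue 3 - 5 / 2 * ∑ i ∈ range K, (-1) ^ i * binomTerm 3 (i + 1) =
      5 / 2 * (2 / 5 * zetaValue 3 - ∑ i ∈ range K, (-1) ^ i * binomTerm 3 (i + 1)) by ring,
    abs_mul, abs_of_pos (by norm_num : (0 : ℝ) < 5 / 2)]
  linarith

end Literature.NumberTheory.Irrationality.VanDerPoorten1979
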